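import Mathlib
import Literature.AlgebraicGeometry.Modules.KilledByLocal
import Summits.ResolutionOfSingularities.ResolutionOfSingularities.Theorems.HomologicalConductorNoZenoFullSheafMaps
import HarnessLib

/-!
# Crux `NoZenoR` (stmt-ResolutionOfSingularities-19943), line `sandwich-cluster`, G-layer:
# functoriality of `S ↦ 𝒪_X · S` in `K(X)`-linear maps, and uniqueness of morphisms on generators

OURS (cell res-hironaka, chain W4.4; KERNEL-L0 §16 R6 row G2 «full-sheaf package», seat res-D-pv-045 AS
res-L0-w44-stub-8). Sequel of `…FullSheaf` / `…FullSheafAffine` / `…FullSheafMaps`. These are the two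
halves of G2 (v) «`End_T(M) = End(M~)`» that do not need (ii): a `T`-linear endomorphism of `M`,
extended `K`-linearly to `V = K^r ⊇ φ(M)`, induces an endomorphism of `M~` (`mapOfLinear`), and an
endomorphism of `M~` is determined by what it does to the generating sections `σ_s`
(`hom_ext_of_app_ofMem`). Nothing of [claim: Hironaka2017] is used.

* `map_mem_stalkSpan` — a `K(X)`-linear `ψ : V → V'` with `ψ(S) ⊆ S'` maps `𝒪_{X,x}·S` into `𝒪_{X,x}·S'`;
* **`mapOfLinear ψ hψ : 𝒪_X · S ⟶ 𝒪_X · S'`** (apply `ψ` to the constant value), with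
  `fn_mapOfLinear_app` (rfl), `mapOfLinear_id`, `mapOfLinear_comp`, `mapOfLinear_add`,
  `mapOfLinear_app_mkSection`;
* **`hom_ext_of_app_ofMem`** — two morphisms `𝒪_X · S ⟶ N` agreeing on the sections `σ_s` (`s ∈ S`)
  over every non-empty affine open are equal (global generation `span_range_ofMem_eq_top` + the
  tree's `eq_of_app_eq_of_iSup_eq_top` for the affine-localizing `𝒪_X · S`).

Everything is proved; no named facts. [this work]
-/

-- single-problem summit: the doubled namespace component `ResolutionOfSingularities` is forced
set_option linter.dupNamespace false

noncomputable section

universe u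

open CategoryTheory AlgebraicGeometry TopologicalSpace Opposite

namespace Summit.ResolutionOfSingularities.ResolutionOfSingularities.Theorems.NoZeno.SandwichCluster.FullSheaf

variable {X : Scheme.{u}} [IsIntegral X]
variable (V : Type u) [AddCommGroup V] [Module X.functionField V] (S : Set V)
variable {V' : Type u} [AddCommGroup V'] [Module X.functionField V'] {S' : Set V'}
variable {V'' : Type u} [AddCommGroup V''] [Module X.functionField V''] {S'' : Set V''}

attribute [local instance] stalkModule stalk_isScalarTower fnModule baseModule

/-! ## Functoriality: `K(X)`-linear maps `ψ : V → V'` with `ψ(S) ⊆ S'` induce `𝒪_X · S ⟶ 𝒪_X · S'` -/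

/-- A `K(X)`-linear map taking `S` into `S'` takes every stalk lattice `𝒪_{X,x} · S` into
`𝒪_{X,x} · S'`. [folklore] -/
theorem map_mem_stalkSpan (ψ : V →ₗ[X.functionField] V') (hψ : Set.MapsTo ψ S S') (x : X) {v : V}
    (hv : v ∈ stalkSpan V S x) : ψ v ∈ stalkSpan V' S' x := by
  induction hv using Submodule.span_induction with
  | mem w hw => exact subset_stalkSpan V' S' x (hψ hw)
  | zero => rw [map_zero]; exact (stalkSpan V' S' x).zero_mem
  | add w w' _ _ hw hw' => rw [map_add]; exact (stalkSpan V' S' x).add_mem hw hw'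
  | smul t w _ hw =>
    rw [stalk_smul_def, LinearMap.map_smul, ← stalk_smul_def]
    exact (stalkSpan V' S' x).smul_mem t hw

variable {V S} in
/-- **The morphism `𝒪_X · S ⟶ 𝒪_X · S'` induced by a `K(X)`-linear `ψ : V → V'` with `ψ(S) ⊆ S'`**
(apply `ψ` to the constant value; e.g. a `T`-linear `u : M → M'` between torsion-free modules,
extended `K`-linearly, induces `M~ ⟶ M'~` — the functoriality behind G2 (v) `End_T(M) → End(M~)`).
[folklore] -/
def mapOfLinear (ψ : V →ₗ[X.functionField] V') (hψ : Set.MapsTo ψ S S') :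
    generatedSheaf (X := X) V S ⟶ generatedSheaf V' S' where
  val := PresheafOfModules.homMk
    { app := fun U => AddCommGrpCat.ofHom
        { toFun := fun s : latticeSubmodule V S U.unop =>
            (⟨fun y => ψ (s.1 y), fun x y => congrArg ψ (s.2.1 x y),
              fun x => map_mem_stalkSpan V S ψ hψ x.1 (s.2.2 x)⟩ : latticeSubmodule V' S' U.unop)
          map_zero' := Subtype.ext (funext fun _ => map_zero ψ)
          map_add' := fun s s' => Subtype.ext (funext fun y => map_add ψ (s.1 y) (s'.1 y)) }
      naturality := fun _ _ _ => rfl }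
    (fun U (g : Γ(X, U.unop)) (s : latticeSubmodule V S U.unop) =>
      Subtype.ext (funext fun y => LinearMap.map_smul ψ (evalFn U.unop y g) (s.1 y)))

/-- The underlying functions of `mapOfLinear ψ`: `ψ ∘ (fn s)`. [folklore] -/
@[simp]
theorem fn_mapOfLinear_app (ψ : V →ₗ[X.functionField] V') (hψ : Set.MapsTo ψ S S') (U : X.Opens)
    (s : Γ(generatedSheaf V S, U)) (y : U) :
    fn V' S' ((mapOfLinear ψ hψ).app U s) y = ψ (fn V S s y) := rfl

/-- `mapOfLinear` of the identity. [folklore] -/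
theorem mapOfLinear_id : mapOfLinear (X := X) (LinearMap.id : V →ₗ[X.functionField] V)
    (Set.mapsTo_id S) = 𝟙 (generatedSheaf V S) := by
  refine Scheme.Modules.hom_ext _ _ fun U => ?_
  ext s
  exact section_ext V S (funext fun y => rfl)

/-- `mapOfLinear` of a composite. [folklore] -/
theorem mapOfLinear_comp (ψ : V →ₗ[X.functionField] V') (hψ : Set.MapsTo ψ S S')
    (ψ' : V' →ₗ[X.functionField] V'') (hψ' : Set.MapsTo ψ' S' S'') :
    mapOfLinear (X := X) (ψ' ∘ₗ ψ) (hψ'.comp hψ) = mapOfLinear ψ hψ ≫ mapOfLinear ψ' hψ' := by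
  refine Scheme.Modules.hom_ext _ _ fun U => ?_
  ext s
  exact section_ext V'' S'' (funext fun y => rfl)

/-- `mapOfLinear` is additive in `ψ`. [folklore] -/
theorem mapOfLinear_add (ψ ψ' : V →ₗ[X.functionField] V') (hψ : Set.MapsTo ψ S S')
    (hψ' : Set.MapsTo ψ' S S') (h : Set.MapsTo (ψ + ψ') S S') :
    mapOfLinear (X := X) (ψ + ψ') h = mapOfLinear ψ hψ + mapOfLinear ψ' hψ' := by
  refine Scheme.Modules.hom_ext _ _ fun U => ?_
  ext s
  exact section_ext V' S' (funext fun y => rfl)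

/-- `mapOfLinear` takes `σ_v` to `σ_{ψ v}` (values). [folklore] -/
theorem mapOfLinear_app_mkSection (ψ : V →ₗ[X.functionField] V') (hψ : Set.MapsTo ψ S S') (U : X.Opens)
    (v : V) (hv : ∀ x ∈ U, v ∈ stalkSpan V S x) :
    (mapOfLinear ψ hψ).app U (mkSection V S U v hv) =
      mkSection V' S' U (ψ v) (fun x hx => map_mem_stalkSpan V S ψ hψ x (hv x hx)) :=
  section_ext V' S' (funext fun _ => rfl)

/-! ## Morphisms out of `𝒪_X · S` are determined by their values on the generators -/

/-- **Uniqueness on generators**: two morphisms `𝒪_X · S ⟶ N` of `𝒪_X`-modules that agree on the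
sections `σ_s` (`s ∈ S`) over every non-empty affine open coincide (global generation on affines,
`span_range_ofMem_eq_top`, + `𝒪_X · S` affine-localizing, tree `eq_of_app_eq_of_iSup_eq_top`).
[folklore] -/
theorem hom_ext_of_app_ofMem {N : X.Modules} (φ ψ : generatedSheaf (X := X) V S ⟶ N)
    (h : ∀ (U : X.Opens), IsAffineOpen U → Nonempty U → ∀ (s : V) (hs : s ∈ S),
      φ.app U (ofMem V S U s hs) = ψ.app U (ofMem V S U s hs)) : φ = ψ := by
  refine Literature.AlgebraicGeometry.Modules.eq_of_app_eq_of_iSup_eq_top φ ψ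
    (isAffineLocalizing_generatedSheaf V S) (fun W : X.affineOpens => W) (iSup_affineOpens_eq_top X) ?_
  intro W m
  rcases isEmpty_or_nonempty (W : X.Opens) with hWe | hWn
  · rw [section_eq_zero_of_isEmpty V S hWe m, map_zero, map_zero]
  · have hm : m ∈ Submodule.span Γ(X, (W : X.Opens))
        (Set.range fun s : S => (ofMem V S (W : X.Opens) s.1 s.2 : Γ(generatedSheaf V S, (W : X.Opens)))) := by
      rw [span_range_ofMem_eq_top V S W.2]; trivial
    induction hm using Submodule.span_induction with
    | mem w hw =>
      obtain ⟨s, rfl⟩ := hw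
      exact h (W : X.Opens) W.2 hWn s.1 s.2
    | zero => rw [map_zero, map_zero]
    | add w w' _ _ hw hw' => rw [map_add, map_add, hw, hw']
    | smul g w _ hw => rw [Scheme.Modules.Hom.app_smul, Scheme.Modules.Hom.app_smul, hw]

end Summit.ResolutionOfSingularities.ResolutionOfSingularities.Theorems.NoZeno.SandwichCluster.FullSheaf

end
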